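import Summits.KontsevichZagierPeriods.KontsevichZagierPeriods.Theses.HurwitzMicroSectors
import Summits.KontsevichZagierPeriods.KontsevichZagierPeriods.Theorems.HurwitzMicroSectorsNormalFormPrinciplePiBoxTransfer
import Summits.KontsevichZagierPeriods.KontsevichZagierPeriods.Theorems.HurwitzMicroSectorsNormalFormPrincipleVariants2319
import Summits.KontsevichZagierPeriods.KontsevichZagierPeriods.Theorems.HurwitzMicroSectorsNormalFormPrincipleBoxRigidityDimOne

/-! TTRL-lite variant V2334 of stmt-KontsevichZagierPeriods-3869

Variant V2334 = `stub_boxRigidity` (the leaf `BoxRigidity` of `NormalFormPrinciple`: two representations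
on open unit boxes with integrands of KZ's rational shape `p/q` over `ℚ` and equal values are
KZ-equivalent) under the DIAGONAL two-sided move `fix_nat:m=8; fix_nat:m'=8` (both dimensions frozen
to `8`). Verdict of the attempt seat: **open** — this file is the exact-strength certificate, not a
proof of the variant. Writing `BoxVanishing K` for "a box-rational representation of dimension `K` and
value `0` is a relation":

* `V2334 ⇒ BoxVanishing 8` (`boxVanishing_eight_of_stub_boxRigidity_var2334`): compare with the zero
  representation on `(0,1)⁸`, which is box-rational, has value `0` and is itself a relation;
* `BoxVanishing 8 ⇒ BoxRigidity for all m, m' ≤ 8 ⇒ V2334` (the tree's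
  `boxRigidityLe_eight_of_boxVanishing_eight`, file `…Variants2319`: pad to `(0,1)⁸`, subtract, soundness);
* hence `V2334 ⟺ BoxVanishing 8 ⟺ BoxRigidity(m, m' ≤ 8) ⟺ V2319`
  (`stub_boxRigidity_var2334_iff_boxVanishing_eight`, `…_iff_le_eight`, `…_iff_var2319`): the diagonal
  pair `(8, 8)` is the SAME fragment of the leaf as the frozen pair `(8, 2)` (V2319) and as
  `m = 8, m' ≤ 2` (V2320) — Conjecture 1 of Kontsevich–Zagier for all rational integrands on the open
  unit boxes of dimension `≤ 8` (among these periods `π⁸`, `ζ(5)`, `ζ(7)`, `ζ(3)ζ(5)`, `ζ(3,5)`, all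
  multiple zeta values of weight `≤ 8`, and in dimension `2` Catalan's `G`: for every `c : ℚ` the
  instance "`G = c → [(0,1)², 1/(1 + x₀²x₁²) − c]` is a relation", provable only through `G ∉ ℚ`);
* `KontsevichZagierPeriods ⇒ parent ⇒ V2334` (`stub_boxRigidity_var2334_of_statement`): a refutation of
  the variant would refute the Summit for the tree's calculus; no invariant of `KZ.relations` finer
  than `KZ.eval` is known, so the negation is unattackable;
* the diagonal rung `8 ↦ 1` is a theorem (`stub_boxRigidity_var2334_rung_one` = `boxRigidity_of_le_one`,
  Baker), and `1` is the largest dimension for which it is.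
Source: M. Kontsevich, D. Zagier, *Periods* (2001), §1.2 Conjecture 1; A. Baker, *Transcendental Number
Theory* (1975), Thm. 2.1 (the rung). Pure proof file, no definitions. -/

-- `Summit.<Summit>.<Problem>` is the tree's mandated summit-side namespace (CONVENTIONS §2); for this
-- single-conjunct summit the two coincide, so the duplicate is deliberate.
set_option linter.dupNamespace false

noncomputable section

namespace Summit.KontsevichZagierPeriods.KontsevichZagierPeriods.Theorems

open MeasureTheory Set
open Literature.NumberTheory.Transcendental Literature.NumberTheory.Transcendental.KZ
open Summit.KontsevichZagierPeriods.KontsevichZagierPeriods.Theses.HurwitzMicroSectors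
open Summit.KontsevichZagierPeriods.HurwitzMicroSectors.NormalFormPrinciple.PiBox

/-! ## V2334 is exactly `BoxVanishing 8` -/

/-- **V2334 ⇒ `BoxVanishing 8`**: a box-rational representation on `(0,1)⁸` of value `0` is, by the
variant, KZ-equivalent to the zero representation on `(0,1)⁸` (box-rational, value `0`), which is itself
a relation (rule 1b)). [cite: KontsevichZagier2001, §1.2 Conjecture 1] -/
theorem boxVanishing_eight_of_stub_boxRigidity_var2334
    (h : ∀ (N : IntegralRep 8) (N' : IntegralRep 8), N.domain = {x | ∀ i, x i ∈ Set.Ioo (0:ℝ) 1} → N.IsRational → N'.domain = {x | ∀ i, x i ∈ Set.Ioo (0:ℝ) 1} → N'.IsRational → N.value = N'.value → Equivalent N N')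
    (M : IntegralRep 8) (hMd : M.domain = {x | ∀ i, x i ∈ Set.Ioo (0:ℝ) 1}) (hMr : M.IsRational)
    (hv : M.value = 0) : of M ∈ relations := by
  obtain ⟨Z, hZd, hZi⟩ := exists_zeroRep (isSemialgebraic_box 8)
  have hZ : of Z ∈ relations := of_mem_relations_of_eqOn_zero Z (by simp [hZi, EqOn])
  have hZv : Z.value = 0 := by simp [IntegralRep.value, hZi]
  have hZr : Z.IsRational := ⟨0, 1, fun x _ => by simp, fun x _ => by simp [hZi]⟩
  have hMZ : of M - of Z ∈ relations := h M Z hMd hMr hZd hZr (by rw [hv, hZv])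
  simpa using relations.add_mem hMZ hZ

/-- **V2334 ⟺ `BoxVanishing 8`** (backward: pad/subtract on `(0,1)⁸`, the tree's
`boxRigidityLe_eight_of_boxVanishing_eight` at `m = m' = 8`). [cite: KontsevichZagier2001, §1.2 Conjecture 1] -/
theorem stub_boxRigidity_var2334_iff_boxVanishing_eight :
    (∀ (N : IntegralRep 8) (N' : IntegralRep 8), N.domain = {x | ∀ i, x i ∈ Set.Ioo (0:ℝ) 1} → N.IsRational → N'.domain = {x | ∀ i, x i ∈ Set.Ioo (0:ℝ) 1} → N'.IsRational → N.value = N'.value → Equivalent N N') ↔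
    (∀ (M : IntegralRep 8), M.domain = {x | ∀ i, x i ∈ Set.Ioo (0:ℝ) 1} → M.IsRational →
      M.value = 0 → of M ∈ relations) :=
  ⟨boxVanishing_eight_of_stub_boxRigidity_var2334,
    fun hvan N N' => boxRigidityLe_eight_of_boxVanishing_eight hvan 8 8 N N' le_rfl le_rfl⟩

/-- **V2334 ⟺ `BoxRigidity` for all `m, m' ≤ 8`**: freezing both dimensions to `8` loses nothing
against bounding both by `8` (padding by unit intervals does not change the value).
[cite: KontsevichZagier2001, §1.2 Conjecture 1] -/
theorem stub_boxRigidity_var2334_iff_le_eight :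
    (∀ (N : IntegralRep 8) (N' : IntegralRep 8), N.domain = {x | ∀ i, x i ∈ Set.Ioo (0:ℝ) 1} → N.IsRational → N'.domain = {x | ∀ i, x i ∈ Set.Ioo (0:ℝ) 1} → N'.IsRational → N.value = N'.value → Equivalent N N') ↔
    (∀ (m m' : ℕ) (N : IntegralRep m) (N' : IntegralRep m'), m ≤ 8 → m' ≤ 8 →
      N.domain = {x | ∀ i, x i ∈ Set.Ioo (0:ℝ) 1} → N.IsRational →
      N'.domain = {x | ∀ i, x i ∈ Set.Ioo (0:ℝ) 1} → N'.IsRational →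
      N.value = N'.value → Equivalent N N') :=
  ⟨fun h => boxRigidityLe_eight_of_boxVanishing_eight (boxVanishing_eight_of_stub_boxRigidity_var2334 h),
    fun h N N' => h 8 8 N N' le_rfl le_rfl⟩

/-- **V2334 ⟺ V2319** (the diagonal pair `(8, 8)` and the frozen pair `(8, 2)` are the same fragment,
`BoxVanishing 8`). [cite: KontsevichZagier2001, §1.2 Conjecture 1] -/
theorem stub_boxRigidity_var2334_iff_var2319 :
    (∀ (N : IntegralRep 8) (N' : IntegralRep 8), N.domain = {x | ∀ i, x i ∈ Set.Ioo (0:ℝ) 1} → N.IsRational → N'.domain = {x | ∀ i, x i ∈ Set.Ioo (0:ℝ) 1} → N'.IsRational → N.value = N'.value → Equivalent N N') ↔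
    (∀ (N : IntegralRep 8) (N' : IntegralRep 2), N.domain = {x | ∀ i, x i ∈ Set.Ioo (0:ℝ) 1} →
      N.IsRational → N'.domain = {x | ∀ i, x i ∈ Set.Ioo (0:ℝ) 1} → N'.IsRational →
      N.value = N'.value → Equivalent N N') :=
  stub_boxRigidity_var2334_iff_boxVanishing_eight.trans
    stub_boxRigidity_var2319_iff_boxVanishing_eight.symm

/-- **V2334 ⇒ `BoxVanishing` in every dimension `j ≤ 8`** (in particular the dimension-`5` statement
containing the `ζ(5)` dichotomy and the dimension-`2` one containing Catalan's).
[cite: KontsevichZagier2001, §1.2 Conjecture 1] -/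
theorem boxVanishing_le_eight_of_stub_boxRigidity_var2334
    (h : ∀ (N : IntegralRep 8) (N' : IntegralRep 8), N.domain = {x | ∀ i, x i ∈ Set.Ioo (0:ℝ) 1} → N.IsRational → N'.domain = {x | ∀ i, x i ∈ Set.Ioo (0:ℝ) 1} → N'.IsRational → N.value = N'.value → Equivalent N N')
    {j : ℕ} (hj : j ≤ 8) (N : IntegralRep j) (hNd : N.domain = {x | ∀ i, x i ∈ Set.Ioo (0:ℝ) 1})
    (hNr : N.IsRational) (hv : N.value = 0) : of N ∈ relations :=
  boxVanishing_le_eight_of_stub_boxRigidity_var2319 (stub_boxRigidity_var2334_iff_var2319.1 h) hj N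
    hNd hNr hv

/-! ## From above: the residual, the parent leaf, the Summit; from below: the proved rung -/

/-- **`BoxVanishing 8` alone already proves V2334** (the honest residual of the variant).
[cite: KontsevichZagier2001, §1.2 Conjecture 1] -/
theorem stub_boxRigidity_var2334_of_boxVanishing_eight
    (hvan : ∀ (M : IntegralRep 8), M.domain = {x | ∀ i, x i ∈ Set.Ioo (0:ℝ) 1} → M.IsRational →
      M.value = 0 → of M ∈ relations) :
    ∀ (N : IntegralRep 8) (N' : IntegralRep 8), N.domain = {x | ∀ i, x i ∈ Set.Ioo (0:ℝ) 1} → N.IsRational → N'.domain = {x | ∀ i, x i ∈ Set.Ioo (0:ℝ) 1} → N'.IsRational → N.value = N'.value → Equivalent N N' :=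
  stub_boxRigidity_var2334_iff_boxVanishing_eight.2 hvan

/-- **The parent leaf ⇒ V2334** (specialisation `m := 8`, `m' := 8`).
[cite: KontsevichZagier2001, §1.2 Conjecture 1] -/
theorem stub_boxRigidity_var2334_of_parent
    (h : ∀ (m m' : ℕ) (N : IntegralRep m) (N' : IntegralRep m'), N.domain = {x | ∀ i, x i ∈ Set.Ioo (0:ℝ) 1} → N.IsRational → N'.domain = {x | ∀ i, x i ∈ Set.Ioo (0:ℝ) 1} → N'.IsRational → N.value = N'.value → Equivalent N N') :
    ∀ (N : IntegralRep 8) (N' : IntegralRep 8), N.domain = {x | ∀ i, x i ∈ Set.Ioo (0:ℝ) 1} → N.IsRational → N'.domain = {x | ∀ i, x i ∈ Set.Ioo (0:ℝ) 1} → N'.IsRational → N.value = N'.value → Equivalent N N' :=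
  h 8 8

/-- **`KontsevichZagierPeriods ⇒ V2334`**: the variant is a special case of Conjecture 1 for the tree's
calculus (`leaves_of_statement`) — so a refutation of the variant would refute the Summit.
[cite: KontsevichZagier2001, §1.2 Conjecture 1] -/
theorem stub_boxRigidity_var2334_of_statement (h : _root_.KontsevichZagierPeriods) :
    ∀ (N : IntegralRep 8) (N' : IntegralRep 8), N.domain = {x | ∀ i, x i ∈ Set.Ioo (0:ℝ) 1} → N.IsRational → N'.domain = {x | ∀ i, x i ∈ Set.Ioo (0:ℝ) 1} → N'.IsRational → N.value = N'.value → Equivalent N N' :=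
  stub_boxRigidity_var2334_of_parent (leaves_of_statement h).1

/-- **The diagonal rung `8 ↦ 1` is a theorem**: the same statement in dimension `1` (both dimensions
frozen to `1`) is the tree's `boxRigidity_of_le_one` (reduced one-variable rational integrands, Baker's
theorem on linear forms in logarithms of algebraic numbers). [cite: KontsevichZagier2001, §1.2 Conjecture 1] -/
theorem stub_boxRigidity_var2334_rung_one :
    ∀ (N : IntegralRep 1) (N' : IntegralRep 1), N.domain = {x | ∀ i, x i ∈ Set.Ioo (0:ℝ) 1} →
      N.IsRational → N'.domain = {x | ∀ i, x i ∈ Set.Ioo (0:ℝ) 1} → N'.IsRational →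
      N.value = N'.value → Equivalent N N' :=
  Dlog.boxRigidity_of_le_one 1 1 le_rfl le_rfl

end Summit.KontsevichZagierPeriods.KontsevichZagierPeriods.Theorems

end
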